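import Summits.HodgeConjecture.HodgeConjecture.Theorems.R90S6BiregularTreeSphereEven   -- ★ W6-b (this base, g2): `ncard_sphere_eq_of_parity_biregular_tree` (spheres of a parity-bi-regular tree); brings ★ `TreeLayers.type_eq_iff_even_dist`
import Literature.Combinatorics.SimpleGraph.TreeDisplacementLayerCount               -- ★ `TreeDisplacement.degree_eq_ncard_neighborSet`
import Literature.Combinatorics.SimpleGraph.LocallyFiniteBall                        -- ★ `ClosedBall.finite_setOf_dist_le` (closed balls of a locally finite connected graph are finite)
import HarnessLib

/-!
# R90 · S6 — generic tree bookkeeping for CARD HF1 (row E1.3.5.2.6, H side): the TYPED BALLS of a `(q+1)`-regular tree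
# (`Theorems/R90S6RegularTreeBallCount.lean`)

Cell `hodgecm-mathlib`, crux H413 (`stmt-HodgeConjecture-24833`), route of record `HCCMUnconditional`; programme R90-TF, section S6 (base `R90-C14`), seat
R90-C14-p03 (g3); card HF1 «Fix AND FIRST SHELLS ON `X₂` FOR THE UNRAMIFIED-`E¹` COMPRESSIONS» (dealer R90-C14-plan (g2), R90 bus 2026-09-05T02:15:20Z).  Helper lane
`--supports stmt-HodgeConjecture-24833 --as helper`; THEOREMS ONLY (no definition, no instance, no notation, no named fact, no `sorry`), for an ARBITRARY vertex type —
the rank-one twins of ★ W6-b∕b′ `R90S6BiregularTreeSphereEven∕Odd` one step further: BALLS, split by the parity type.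

THE MATHEMATICS (Serre, *Trees*, I.2.3 Ex. 2, II.1.1).  `G` a tree, `x₀` a root, `c : V → Fin 2` a type function taking different values at adjacent vertices with `c x₀ = 0`
(on the Bruhat–Tits tree of `U(1,1)_w`: self-dual ↦ `0`, `ϖ`-modular ↦ `1`), every vertex of valency `q + 1` (finite neighbour sets).  Then `c v = 0 ↔ d(x₀, v)` even (★
`TreeLayers.type_eq_iff_even_dist`), the sphere of radius `m ≥ 1` has `(q+1) q^{m−1}` vertices (★ W6-b `ncard_sphere_eq_of_parity_biregular_tree` at `a = b = q`), balls are finite (★ `ClosedBall.finite_setOf_dist_le`), hence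
**`#{v : d(x₀,v) ≤ m, c v = 0} = 1 + (q+1) Σ_{j < ⌊m∕2⌋} q^{2j+1}`** and **`#{v : d(x₀,v) ≤ m, c v = 1} = (q+1) Σ_{j < ⌊(m+1)∕2⌋} q^{2j}`** (§2; `m = 0`: `1` and `0`;
`m = 1`: `1` and `q+1`; `m = 2`: `1 + (q+1)q` and `q+1`).
HONEST LABEL: elementary tree combinatorics; proves no printed statement, discharges no citation; count-neutral helper for HF1 ∕ (E1).
HC_CM is proved only modulo the 7 printed citations (2 remaining named inputs: hLiu418 = stmt-HodgeConjecture-24832, h413 = stmt-HodgeConjecture-24833) until rung 0 closes; REL ≠ ★ ≠ BUILT.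

## References
* [Serre1980Trees] J.-P. Serre, *Trees* (1980): I.2.3 (Ex. 2: spheres of a regular tree), I.6.4 Prop. 24, II.1.1 (the tree of a rank-one group, two vertex types).
* [Diestel2010] R. Diestel, *Graph Theory*, 4th ed. (2010): Thm. 1.5.1, §1.3 (paths in trees, distance layers).
-/

set_option autoImplicit false
-- the mandated namespace repeats the single-problem summit's segment (`HodgeConjecture.HodgeConjecture`)
set_option linter.dupNamespace false

open SimpleGraph
open Literature.Combinatorics.SimpleGraph

namespace Summit.HodgeConjecture.HodgeConjecture.R90.S6

variable {V : Type*} {G : SimpleGraph V}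

/-! ## §1 The last step of a geodesic -/

/-- In a connected graph, a vertex at distance `m + 1` from `x₀` has a neighbour at distance `≤ m` from `x₀` (the last-but-one vertex of a geodesic). [cite: Diestel2010, §1.3] -/
theorem exists_adj_dist_le_of_dist_eq_succ (hconn : G.Connected) (x₀ : V) {v : V} {m : ℕ} (hv : G.dist x₀ v = m + 1) :
    ∃ y, G.Adj y v ∧ G.dist x₀ y ≤ m := by
  obtain ⟨W, hW⟩ := hconn.exists_walk_length_eq_dist v x₀
  rw [SimpleGraph.dist_comm, hv] at hW
  cases W with
  | nil => simp at hW
  | cons h W' =>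
    rename_i y
    refine ⟨y, h.symm, ?_⟩
    rw [SimpleGraph.Walk.length_cons] at hW
    rw [SimpleGraph.dist_comm]
    exact (SimpleGraph.dist_le W').trans (by omega)

/-! ## §2 Typed spheres and typed balls of a `(q+1)`-regular tree -/

/-- **Spheres of a `(q+1)`-regular tree**: `#{v : d(x₀, v) = m} = (q+1) q^{m−1}` for `m ≥ 1` — the `a = b = q` case of ★ W6-b `ncard_sphere_eq_of_parity_biregular_tree`,
in the `ncard`-valency currency of ★ H2-NUMBERS (`hnb`, `hdeg`). [cite: Serre1980Trees, I.2.3 Ex. 2, II.1.1] -/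
theorem ncard_sphere_eq_of_regular_tree (hT : G.IsTree) (x₀ : V) (hnb : ∀ v, (G.neighborSet v).Finite) (q : ℕ)
    (hdeg : ∀ v, (G.neighborSet v).ncard = q + 1) {m : ℕ} (hm : 1 ≤ m) : {v | G.dist x₀ v = m}.ncard = (q + 1) * q ^ (m - 1) := by
  haveI : G.LocallyFinite := fun v => (hnb v).fintype
  rw [ncard_sphere_eq_of_parity_biregular_tree G hT x₀ q q
      (fun x => by rw [TreeDisplacement.degree_eq_ncard_neighborSet, hdeg]; split_ifs <;> rfl) m hm, mul_assoc, ← pow_add]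
  congr 2
  omega

/-- **Typed spheres**: `#{v : d(x₀, v) = m ∧ c v = i}` is the whole sphere when `i` has the parity of `m` (`c v = 0 ↔ d(x₀,v)` even, ★ `TreeLayers.type_eq_iff_even_dist`) and is
empty otherwise. [cite: Serre1980Trees, II.1.1] -/
theorem ncard_sphere_inter_type_eq (hT : G.IsTree) (x₀ : V) (c : V → Fin 2) (hc : ∀ v w, G.Adj v w → c v ≠ c w) (h0 : c x₀ = 0) (m : ℕ) (i : Fin 2) :
    {v | G.dist x₀ v = m ∧ c v = i}.ncard = if (Even m ↔ i = 0) then {v | G.dist x₀ v = m}.ncard else 0 := by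
  have htype : ∀ v, c v = 0 ↔ Even (G.dist x₀ v) := fun v => by rw [← h0]; exact TreeLayers.type_eq_iff_even_dist hT x₀ c hc v
  have fin2 : ∀ x y : Fin 2, x = y ↔ (x = 0 ↔ y = 0) := by decide
  -- on the sphere of radius `m`: `c v = i ↔ (Even m ↔ i = 0)`
  have key : ∀ v, G.dist x₀ v = m → (c v = i ↔ (Even m ↔ i = 0)) := fun v hv => by
    rw [fin2 (c v) i, htype v, hv]
  split_ifs with hpar
  · congr 1
    ext v
    simp only [Set.mem_setOf_eq]
    exact ⟨fun h => h.1, fun h => ⟨h, (key v h).2 hpar⟩⟩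
  · have hempty : {v | G.dist x₀ v = m ∧ c v = i} = ∅ := by
      ext v
      simp only [Set.mem_setOf_eq, Set.mem_empty_iff_false, iff_false, not_and]
      exact fun hv hi => hpar ((key v hv).1 hi)
    rw [hempty, Set.ncard_empty]

/-- **THE TYPE-`0` BALL**: `#{v : d(x₀, v) ≤ m ∧ c v = 0} = 1 + (q+1) Σ_{j < ⌊m∕2⌋} q^{2j+1}` — the root and the even spheres `(q+1)q^{2j−1}`, `1 ≤ j ≤ ⌊m∕2⌋`.
(`U(1,1)_w`: the self-dual vertices of the ball of radius `m` about `𝒪²`.) [cite: Serre1980Trees, I.2.3 Ex. 2, II.1.1] -/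
theorem ncard_ball_inter_type_zero_eq (hT : G.IsTree) (x₀ : V) (c : V → Fin 2) (hc : ∀ v w, G.Adj v w → c v ≠ c w) (h0 : c x₀ = 0)
    (hnb : ∀ v, (G.neighborSet v).Finite) (q : ℕ) (hdeg : ∀ v, (G.neighborSet v).ncard = q + 1) (m : ℕ) :
    {v | G.dist x₀ v ≤ m ∧ c v = 0}.ncard = 1 + (q + 1) * ∑ j ∈ Finset.range (m / 2), q ^ (2 * j + 1) := by
  induction m with
  | zero =>
    rw [Nat.zero_div, Finset.range_zero, Finset.sum_empty, mul_zero, add_zero]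
    have hset : {v | G.dist x₀ v ≤ 0 ∧ c v = 0} = {x₀} := by
      ext v
      simp only [Set.mem_setOf_eq, Nat.le_zero, Set.mem_singleton_iff, hT.1.dist_eq_zero_iff]
      constructor
      · rintro ⟨h, -⟩; exact h.symm
      · rintro rfl; exact ⟨rfl, h0⟩
    rw [hset, Set.ncard_singleton]
  | succ m ih =>
    have hsplit : {v | G.dist x₀ v ≤ m + 1 ∧ c v = 0} = {v | G.dist x₀ v ≤ m ∧ c v = 0} ∪ {v | G.dist x₀ v = m + 1 ∧ c v = 0} := by
      ext v; simp only [Set.mem_setOf_eq, Set.mem_union]; omega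
    have hdisj : Disjoint {v | G.dist x₀ v ≤ m ∧ c v = 0} {v | G.dist x₀ v = m + 1 ∧ c v = 0} := by
      rw [Set.disjoint_left]; rintro v ⟨h1, -⟩ ⟨h2, -⟩; omega
    rw [hsplit, Set.ncard_union_eq hdisj ((ClosedBall.finite_setOf_dist_le hnb hT.1 x₀ m).subset fun v hv => hv.1)
      ((ClosedBall.finite_setOf_dist_le hnb hT.1 x₀ (m + 1)).subset fun v hv => le_of_eq hv.1), ih,
      ncard_sphere_inter_type_eq hT x₀ c hc h0 (m + 1) 0]
    by_cases hm : Even (m + 1)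
    · rw [if_pos (iff_of_true hm rfl), ncard_sphere_eq_of_regular_tree hT x₀ hnb q hdeg (by omega : 1 ≤ m + 1), Nat.add_sub_cancel]
      have e1 : (m + 1) / 2 = m / 2 + 1 := by obtain ⟨k, hk⟩ := hm; omega
      have e2 : 2 * (m / 2) + 1 = m := by obtain ⟨k, hk⟩ := hm; omega
      rw [e1, Finset.sum_range_succ, e2]
      ring
    · rw [if_neg (fun h => hm (h.2 rfl)), add_zero]
      have heven : Even m := by rwa [Nat.even_add_one, not_not] at hm
      have e1 : (m + 1) / 2 = m / 2 := by obtain ⟨k, hk⟩ := heven; omega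
      rw [e1]

/-- **THE TYPE-`1` BALL**: `#{v : d(x₀, v) ≤ m ∧ c v = 1} = (q+1) Σ_{j < ⌊(m+1)∕2⌋} q^{2j}` — the odd spheres `(q+1)q^{2j}`, `2j + 1 ≤ m`.
(`U(1,1)_w`: the `ϖ`-modular vertices of the ball of radius `m` about `𝒪²`.) [cite: Serre1980Trees, I.2.3 Ex. 2, II.1.1] -/
theorem ncard_ball_inter_type_one_eq (hT : G.IsTree) (x₀ : V) (c : V → Fin 2) (hc : ∀ v w, G.Adj v w → c v ≠ c w) (h0 : c x₀ = 0)
    (hnb : ∀ v, (G.neighborSet v).Finite) (q : ℕ) (hdeg : ∀ v, (G.neighborSet v).ncard = q + 1) (m : ℕ) :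
    {v | G.dist x₀ v ≤ m ∧ c v = 1}.ncard = (q + 1) * ∑ j ∈ Finset.range ((m + 1) / 2), q ^ (2 * j) := by
  induction m with
  | zero =>
    rw [show (0 + 1) / 2 = 0 from rfl, Finset.range_zero, Finset.sum_empty, mul_zero]
    have hempty : {v | G.dist x₀ v ≤ 0 ∧ c v = 1} = ∅ := by
      ext v
      simp only [Set.mem_setOf_eq, Nat.le_zero, Set.mem_empty_iff_false, iff_false, not_and, hT.1.dist_eq_zero_iff]
      rintro rfl
      rw [h0]; decide
    rw [hempty, Set.ncard_empty]
  | succ m ih =>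
    have hsplit : {v | G.dist x₀ v ≤ m + 1 ∧ c v = 1} = {v | G.dist x₀ v ≤ m ∧ c v = 1} ∪ {v | G.dist x₀ v = m + 1 ∧ c v = 1} := by
      ext v; simp only [Set.mem_setOf_eq, Set.mem_union]; omega
    have hdisj : Disjoint {v | G.dist x₀ v ≤ m ∧ c v = 1} {v | G.dist x₀ v = m + 1 ∧ c v = 1} := by
      rw [Set.disjoint_left]; rintro v ⟨h1, -⟩ ⟨h2, -⟩; omega
    rw [hsplit, Set.ncard_union_eq hdisj ((ClosedBall.finite_setOf_dist_le hnb hT.1 x₀ m).subset fun v hv => hv.1)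
      ((ClosedBall.finite_setOf_dist_le hnb hT.1 x₀ (m + 1)).subset fun v hv => le_of_eq hv.1), ih,
      ncard_sphere_inter_type_eq hT x₀ c hc h0 (m + 1) 1]
    by_cases hm : Even (m + 1)
    · rw [if_neg (fun h => absurd (h.1 hm) (by decide)), add_zero]
      have e1 : (m + 1 + 1) / 2 = (m + 1) / 2 := by obtain ⟨k, hk⟩ := hm; omega
      rw [e1]
    · have heven : Even m := by rwa [Nat.even_add_one, not_not] at hm
      rw [if_pos ⟨fun h => absurd h hm, fun h => absurd h (by decide)⟩,
        ncard_sphere_eq_of_regular_tree hT x₀ hnb q hdeg (by omega : 1 ≤ m + 1), Nat.add_sub_cancel]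
      have e1 : (m + 1 + 1) / 2 = (m + 1) / 2 + 1 := by obtain ⟨k, hk⟩ := heven; omega
      have e2 : 2 * ((m + 1) / 2) = m := by obtain ⟨k, hk⟩ := heven; omega
      rw [e1, Finset.sum_range_succ, e2]
      ring


end Summit.HodgeConjecture.HodgeConjecture.R90.S6
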